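import Mathlib.Analysis.SpecialFunctions.Log.Base
import Literature.InformationTheory.Entropy.MapEntropy

/-!
# Route CodingVolumeShifts — crux `CodingVolume` (stmt-PneNP-19454): entropy on the Boolean cube

Entropy bookkeeping for functions of a uniform point of the cube `ι → Bool` (the input of a one-shot
network code), for the entropy form of the volume arguments (see the blueprint attached to the item):

* `codingVolume_card_fiber_pair_coords` — if `F` ignores the coordinates in `Q`, the fibre of `F`
  through `x` is `2^|Q|` times the fibre of `(F, x|_Q)`;
* `codingVolume_mapEntropy_pair_coords` — hence `H(F, x|_Q) = H(F) + |Q|` (independent fresh bits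
  add their number);
* `codingVolume_mapEntropy_coords` — `H(x|_Q) = |Q|`.

No definitions. [folklore]
-/

set_option linter.dupNamespace false -- `Summit.PneNP.PneNP.…`: summit = sub-problem name (D-0017)

namespace Summit.PneNP.PneNP.Theorems

open Literature.InformationTheory.Entropy Finset

section Cube

variable {ι : Type} [Fintype ι] [DecidableEq ι] {β : Type*} [DecidableEq β]

/-- Overwrite the coordinates in `Q` of `x` by those of `y`. (Local helper, spelled inline below as
`fun i => if i ∈ Q then y i else x i`.) If `F` ignores the coordinates in `Q`, then on the fibre of
`F` through `x` the map `x' ↦ (x'|_Q, overwrite x' by x on Q)` is a bijection onto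
`(Q → Bool) × (fibre of (F, ·|_Q) through x)`; hence the cardinality identity
`|fibre_F(x)| = 2^|Q| · |fibre_{(F, ·|_Q)}(x)|`. [folklore] -/
theorem codingVolume_card_fiber_pair_coords (Q : Finset ι) (F : (ι → Bool) → β)
    (hF : ∀ x x' : ι → Bool, (∀ i, i ∉ Q → x i = x' i) → F x = F x') (x : ι → Bool) :
    (fiber (univ : Finset (ι → Bool)) F (F x)).card =
      2 ^ Q.card * (fiber (univ : Finset (ι → Bool)) (fun z => (F z, fun i : Q => z i))
        (F x, fun i : Q => x i)).card := by
  classical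
  -- the bijection
  let e : (ι → Bool) → (Q → Bool) × (ι → Bool) := fun z => (fun i => z i, fun i => if i ∈ Q then x i else z i)
  have he_inj : Set.InjOn e ↑(fiber (univ : Finset (ι → Bool)) F (F x)) := by
    intro z _ z' _ h
    simp only [e, Prod.mk.injEq] at h
    obtain ⟨h1, h2⟩ := h
    funext i
    by_cases hi : i ∈ Q
    · exact congrFun h1 ⟨i, hi⟩
    · have := congrFun h2 i
      simpa [hi] using this
  have himage : (fiber (univ : Finset (ι → Bool)) F (F x)).image e =
      (univ : Finset (Q → Bool)) ×ˢ
        fiber (univ : Finset (ι → Bool)) (fun z => (F z, fun i : Q => z i)) (F x, fun i : Q => x i) := by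
    ext ⟨q, w⟩
    simp only [Finset.mem_image, mem_fiber, Finset.mem_univ, true_and, Finset.mem_product,
      Prod.mk.injEq, e]
    constructor
    · rintro ⟨z, hz, rfl, rfl⟩
      refine ⟨?_, ?_⟩
      · rw [← hz]
        exact hF _ _ (fun i hi => by simp [hi])
      · funext ⟨i, hi⟩
        simp [hi]
    · rintro ⟨hw, hwQ⟩
      refine ⟨fun i => if h : i ∈ Q then q ⟨i, h⟩ else w i, ?_, ?_, ?_⟩
      · rw [← hw]
        exact hF _ _ (fun i hi => by simp [hi])
      · funext ⟨i, hi⟩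
        simp [hi]
      · funext i
        by_cases hi : i ∈ Q
        · simp only [hi, if_true, dif_pos]
          exact (congrFun hwQ ⟨i, hi⟩).symm
        · simp [hi]
  rw [← Finset.card_image_of_injOn he_inj, himage, Finset.card_product, Finset.card_univ,
    Fintype.card_fun, Fintype.card_bool, Fintype.card_coe]

/-- **Fresh independent bits add their number**: if `F` ignores the coordinates in `Q`, then
`H(F, x|_Q) = H(F) + |Q|` for a uniform point `x` of the cube. [folklore] -/
theorem codingVolume_mapEntropy_pair_coords (Q : Finset ι) (F : (ι → Bool) → β)
    (hF : ∀ x x' : ι → Bool, (∀ i, i ∉ Q → x i = x' i) → F x = F x') :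
    mapEntropy (univ : Finset (ι → Bool)) (fun z => (F z, fun i : Q => z i)) =
      mapEntropy (univ : Finset (ι → Bool)) F + Q.card := by
  classical
  have hN : ((univ : Finset (ι → Bool)).card : ℝ) ≠ 0 := by
    exact_mod_cast (Finset.card_pos.mpr ⟨fun _ => false, Finset.mem_univ _⟩).ne'
  -- pointwise: the surprise of the pair exceeds that of `F` by `|Q|`
  have hpt : ∀ x : ι → Bool,
      Real.logb 2 (((univ : Finset (ι → Bool)).card : ℝ) /
        (fiber (univ : Finset (ι → Bool)) (fun z => (F z, fun i : Q => z i))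
          (F x, fun i : Q => x i)).card) =
      Real.logb 2 (((univ : Finset (ι → Bool)).card : ℝ) /
        (fiber (univ : Finset (ι → Bool)) F (F x)).card) + Q.card := by
    intro x
    have hpos : (0 : ℝ) < (fiber (univ : Finset (ι → Bool)) (fun z => (F z, fun i : Q => z i))
        (F x, fun i : Q => x i)).card := by
      exact_mod_cast card_fiber_pos (S := univ) (fun z => (F z, fun i : Q => z i))
        (Finset.mem_univ x)
    have hpow : (0 : ℝ) < (2 : ℝ) ^ Q.card := by positivity
    have hNpos : (0 : ℝ) < ((univ : Finset (ι → Bool)).card : ℝ) :=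
      lt_of_le_of_ne (Nat.cast_nonneg _) (Ne.symm hN)
    rw [codingVolume_card_fiber_pair_coords Q F hF x, Nat.cast_mul, Nat.cast_pow, Nat.cast_ofNat,
      div_mul_eq_div_div_swap, Real.logb_div (div_pos hNpos hpos).ne' hpow.ne',
      Real.logb_pow, Real.logb_self_eq_one one_lt_two]
    ring
  unfold mapEntropy
  rw [Finset.sum_congr rfl fun x _ => hpt x, Finset.sum_add_distrib, add_div, Finset.sum_const,
    nsmul_eq_mul, mul_div_cancel_left₀ _ hN]

/-- The coordinates in `Q` of a uniform point of the cube have entropy `|Q|`. [folklore] -/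
theorem codingVolume_mapEntropy_coords (Q : Finset ι) :
    mapEntropy (univ : Finset (ι → Bool)) (fun z => fun i : Q => z i) = Q.card := by
  classical
  have h := codingVolume_mapEntropy_pair_coords (β := Unit) Q (fun _ => ()) (fun _ _ _ => rfl)
  rw [mapEntropy_const, zero_add] at h
  rw [← h]
  -- `(fun z => ((), z|_Q))` is an injective post-processing of `z|_Q`
  have : (fun z : ι → Bool => ((), fun i : Q => z i)) =
      (fun q : Q → Bool => ((), q)) ∘ (fun z : ι → Bool => fun i : Q => z i) := rfl
  rw [this, mapEntropy_comp_of_injOn]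
  intro a _ b _ hab
  simpa using hab

end Cube

end Summit.PneNP.PneNP.Theorems
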